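import Summits.NavierStokesRegularity.FluidComputer.BandFluxCeiling
import Literature.Analysis.FluidPDE.LerayHopfRestartEverywhere
import HarnessLib

/-!
# Fluid computer — the TIME FACE of the level dictionary, I: LERAY'S ENSTROPHY CLOCK (L19)

HONEST FRAMING (cell `pub-fluidc`, verbatim): *low prior, high value-of-information experiment on Tao's
machine paradigm; NOT a claim that NS blows up.* Theorem side of the cell; nothing here is evidence of blow-up.
Every statement is a NECESSITY obeyed by every maximal smooth finite-energy solution: if `(u, p)` is a maximal
smooth solution of the unforced Navier–Stokes system on `ℝ³ × [0, T)` (`ν > 0`; classical on `[0, T)`, no smooth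
extension past `T`) which is Leray–Hopf from `u 0`, then AT EVERY INSTANT `t < T` the time still to run is
bounded BELOW by the enstrophy at time `t`:

* `enstrophy_clock` (**L19, LERAY'S `H¹` CLOCK**) — an absolute `c > 0` with
  `c ν³ ≤ (∫|∇u(t)|²)² · (T − t)` for every `t ∈ [0, T)` (Leray 1934, §20; Robinson–Rodrigo–Sadowski 2016,
  Lemma 6.11: `c/‖∇u(t)‖⁴ ≤ T* − t`). Read as a COUNTDOWN: a flow whose enstrophy is `Z` at time `t` is at least
  `c ν³/Z²` away from its blow-up time; read as a RATE: `∫|∇u(t)|² ≥ √(c ν³/(T − t))`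
  (`enstrophy_clock_toReal`: the same in real numbers on `(0, T)`, where the enstrophy is finite).
  The published rates in the tree (`leray_blowup_rate_holds`, `leray_blowup_rate_top_holds`: Leray's `L^r` and
  `L^∞` rates) carry an essential-boundedness hypothesis on closed sub-strips, and the forced
  `ClayBlowup.enstrophy_rate` asks a Schwartz datum; the dictionary's class has neither, so the clock is assembled
  here from tree theorems only:
* `isLerayHopfOn_translate` — RESTART AT EVERY INTERIOR TIME: for every `t ∈ (0, T)` and `T₂ ∈ (t, T)` the
  translate `u(· + t)` is Leray–Hopf on `[0, T₂ − t)` from `u(t)` (a.e. restart, interior boundedness by far-field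
  ε-regularity `SereginSverak2002.farField_bound` plus compact continuity, and
  `IsLerayHopfOn.isLerayHopfOn_translate_of_bound` — in Serrin's class every time is a good time);
* `hasSmoothExtensionPast_of_enstrophy_lt` — THE CONTINUATION STEP: if `(∫|∇u(t)|²)² (T − t) < c ν³` then `u`
  extends classically past `T` (Leray's local strong `H¹` solution with lifespan `c ν³ ‖∇u₀‖₂⁻⁴`,
  `leray_local_strong_H1` = RRS Thm. 6.15, proved in the tree; its classical representative in the Serrin class
  `L^∞_t L⁶_x`, `ladyzhenskaya_prodi_serrin_holds`; weak–strong uniqueness `serrin_weak_strong_uniqueness_holds`;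
  gluing `IsClassicalNSSolutionOn.glue`).

The level-currency forms of the clock (dyadic enstrophy, enstrophy front, per-level countdown) are in the
companion module `LerayFrontClock`. HONEST SIZE NOTE: `c` is inexplicit (Sobolev × Serrin constants of the `H¹`
theory) and the clock carries `ν³` (`≈ 3.7·10⁻⁸` at the cell's `ρ = 3`): like the flux floors it is read against
WORDS ('time-to-blow-up is bounded below by the state'), never against a certified number of the atlas.
Necessity only; nothing about sufficiency. 0 sorry; no new definitions, no named facts.

## References

* J. Leray, Acta Math. 63 (1934) 193–248, §20 (the `H¹` lifespan and rate). [Leray1934]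
* J. C. Robinson, J. L. Rodrigo, W. Sadowski, *The Three-Dimensional Navier–Stokes Equations*, CUP 2016,
  Lemma 6.11 with Thm. 6.15, Thm. 6.10, Thm. 8.17, Def. 4.9. [RobinsonRodrigoSadowski2016]
-/

noncomputable section

open MeasureTheory Set Function Filter Topology Metric
open scoped ENNReal NNReal RealInnerProductSpace
open Literature.Analysis.FluidPDE Literature.Analysis.FunctionSpaces
open Literature.Analysis.FluidPDE.LPBounds (gradSq)
open Summit.NavierStokesRegularity.FluidComputer.BlockEnergyTransport
open Summit.NavierStokesRegularity.FluidComputer.BandFluxCeiling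

namespace Summit.NavierStokesRegularity.FluidComputer.LerayClock

/-! ## Restarting a classical Leray–Hopf solution at EVERY interior time -/

/-- **Restart at every interior time, on every shorter window.** Let `(u, p)` be a classical solution of the
unforced Navier–Stokes system on `ℝ³ × [0, T)` (`ν > 0`) which is Leray–Hopf on `[0, T)` from `u 0`. Then for
EVERY `t ∈ (0, T)` and every `T₂ ∈ (t, T)` the translate `u(· + t)` is a Leray–Hopf weak solution on
`[0, T₂ − t)` from `u(t)`. Proof: restart at an a.e.-good time `s₁ ∈ (t/2, t)`
(`IsLerayHopfOn.exists_isLerayHopfOn_restart_Ioo`); the translate `u(· + s₁)` is classical and BOUNDED on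
`[0, T₂ − s₁] × ℝ³` — in the far field by ε-regularity (`SereginSverak2002.farField_bound`), on the compact
`[s₁, T₂] × B̄(0, R)` by continuity — so it restarts from every time by
`IsLerayHopfOn.isLerayHopfOn_translate_of_bound` (Serrin's class: every time is a good time).
[cite: RobinsonRodrigoSadowski2016, Def. 4.9 with Cor. 4.8 and Thm. 8.17] -/
theorem isLerayHopfOn_translate {ν T : ℝ} (hν : 0 < ν) (hT : 0 < T)
    {u : ℝ → EuclideanSpace ℝ (Fin 3) → EuclideanSpace ℝ (Fin 3)} {p : ℝ → EuclideanSpace ℝ (Fin 3) → ℝ}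
    (hcl : IsClassicalNSSolutionOn (Ico 0 T) ν 0 u p) (hLH : IsLerayHopfOn T ν 0 (u 0) u)
    {t : ℝ} (ht : t ∈ Ioo 0 T) {T₂ : ℝ} (hT₂ : T₂ ∈ Ioo t T) :
    IsLerayHopfOn (T₂ - t) ν 0 (u t) (fun s => u (s + t)) := by
  -- an a.e.-good restart time `s₁ ∈ (t/2, t)`
  obtain ⟨s₁, hs₁, hLH₁⟩ := hLH.exists_isLerayHopfOn_restart_Ioo hν.le (a := t / 2) (b := t)
    (by linarith [ht.1]) (by linarith [ht.1]) ht.2.le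
  have hs₁0 : 0 < s₁ := by linarith [hs₁.1, ht.1]
  have hT₂s₁ : 0 < T₂ - s₁ := by linarith [hs₁.2, hT₂.1]
  -- the translate `u(· + s₁)` is classical on `[0, T₂ - s₁)`
  have hcl₁ : IsClassicalNSSolutionOn (Ico 0 (T₂ - s₁)) ν 0 (fun s => u (s + s₁)) (fun s => p (s + s₁)) := by
    have h := hcl.comp_add_right s₁
    have h0 : (fun s => (0 : ℝ → EuclideanSpace ℝ (Fin 3) → EuclideanSpace ℝ (Fin 3)) (s + s₁)) = 0 := rfl
    rw [h0] at h
    refine h.mono (fun s hs => ?_) (uniqueDiffOn_Ico 0 (T₂ - s₁))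
    simp only [mem_preimage, mem_Ico] at hs ⊢
    exact ⟨by linarith [hs.1], by linarith [hs.2, hT₂.2]⟩
  -- it is Leray–Hopf on `[0, T₂ - s₁)` from `u s₁`
  have hLH₂ : IsLerayHopfOn (T₂ - s₁) ν 0 (u s₁) (fun s => u (s + s₁)) :=
    hLH₁.of_le (by linarith [hT₂.2])
  -- and bounded on `[0, T₂ - s₁] × ℝ³`: far field by ε-regularity, near field by continuity
  obtain ⟨R, M₁, hfar⟩ := SereginSverak2002.farField_bound hν hT hcl hLH (δ := t / 2) (by linarith [ht.1])
  set K : Set (ℝ × EuclideanSpace ℝ (Fin 3)) := Icc s₁ T₂ ×ˢ closedBall (0 : EuclideanSpace ℝ (Fin 3)) R with hK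
  have hKc : IsCompact K := isCompact_Icc.prod (isCompact_closedBall _ _)
  have hKsub : K ⊆ Ico 0 T ×ˢ (univ : Set (EuclideanSpace ℝ (Fin 3))) := by
    rintro ⟨s, x⟩ ⟨⟨hs1, hs2⟩, -⟩
    exact ⟨⟨hs₁0.le.trans hs1, hs2.trans_lt hT₂.2⟩, mem_univ _⟩
  obtain ⟨M₂, hM₂⟩ := hKc.exists_bound_of_continuousOn ((SereginSverak2002.continuousOn_uncurry hcl).mono hKsub)
  have hM : ∀ s ∈ Icc 0 (T₂ - s₁), ∀ x, ‖(fun s => u (s + s₁)) s x‖ ≤ max M₁ M₂ := by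
    intro s hs x
    have hss₁ : s + s₁ ∈ Icc s₁ T₂ := ⟨by linarith [hs.1], by linarith [hs.2]⟩
    rcases lt_or_ge R ‖x‖ with hx | hx
    · exact (hfar (s + s₁) ⟨by linarith [hss₁.1, hs₁.1], hss₁.2.trans_lt hT₂.2⟩ x hx).trans (le_max_left _ _)
    · have hmem : ((s + s₁, x) : ℝ × EuclideanSpace ℝ (Fin 3)) ∈ K := ⟨hss₁, mem_closedBall_zero_iff.2 hx⟩
      exact (hM₂ (s + s₁, x) hmem).trans (le_max_right _ _)
  -- restart of the bounded classical Leray–Hopf solution `u(· + s₁)` at the time `t - s₁`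
  have hts : t - s₁ ∈ Ioo 0 (T₂ - s₁) := ⟨by linarith [hs₁.2], by linarith [hT₂.1]⟩
  have key := hLH₂.isLerayHopfOn_translate_of_bound hν hT₂s₁ (hLH.memLp s₁ ⟨hs₁0.le, by linarith [hs₁.2, ht.2]⟩)
    hcl₁ hM hts
  have e1 : T₂ - s₁ - (t - s₁) = T₂ - t := by ring
  have e2 : u (t - s₁ + s₁) = u t := by rw [sub_add_cancel]
  have e3 : (fun s => u (s + (t - s₁) + s₁)) = fun s => u (s + t) := by
    funext s
    congr 1
    ring
  rw [e1, e2, e3] at key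
  exact key

/-! ## The continuation step: small enstrophy near `T` extends the solution past `T` -/

/-- **Leray's continuation step** (Robinson–Rodrigo–Sadowski 2016, proof of Lemma 6.11 with Thm. 6.15,
Thm. 8.17 and Thm. 6.10). Let `c` be a lifespan constant of Leray's local strong `H¹` theory
(`LerayLocalStrongH1With c`), `(u, p)` a classical solution of the unforced system on `ℝ³ × [0, T)` (`ν > 0`),
Leray–Hopf from `u 0`, and `t ∈ [0, T)` a time from which `u` restarts as a Leray–Hopf solution on every window
`[0, T₂ − t)`, `T₂ < T`. If `(∫|∇u(t)|²)² (T − t) < c ν³`, then `u` extends as a classical solution past `T`: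
Leray's strong solution from `u(t)` lives longer than `T − t`, coincides with `u(· + t)` by weak–strong uniqueness
(its classical representative lies in `L^∞_t L⁶_x`), and glues to `u` along `(t, T)`.
[cite: RobinsonRodrigoSadowski2016, Lemma 6.11 (proof) with Thms 6.15, 8.17, 6.10] -/
theorem hasSmoothExtensionPast_of_enstrophy_lt {ν T c : ℝ} (hν : 0 < ν) (hc : 0 < c)
    (hloc : LerayLocalStrongH1With c)
    {u : ℝ → EuclideanSpace ℝ (Fin 3) → EuclideanSpace ℝ (Fin 3)} {p : ℝ → EuclideanSpace ℝ (Fin 3) → ℝ}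
    (hcl : IsClassicalNSSolutionOn (Ico 0 T) ν 0 u p) (hLH : IsLerayHopfOn T ν 0 (u 0) u)
    {t : ℝ} (ht : t ∈ Ico 0 T)
    (hrestart : ∀ T₂ ∈ Ioo t T, IsLerayHopfOn (T₂ - t) ν 0 (u t) (fun s => u (s + t)))
    (hlt : (∫⁻ x, ENNReal.ofReal (frobeniusNormSq (fderiv ℝ (u t) x))) ^ 2 * ENNReal.ofReal (T - t) <
      ENNReal.ofReal (c * ν ^ 3)) :
    HasSmoothExtensionPast ν 0 u T := by
  have hLPS : ladyzhenskaya_prodi_serrin := ladyzhenskaya_prodi_serrin_holds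
  set Z : ℝ≥0∞ := ∫⁻ x, ENNReal.ofReal (frobeniusNormSq (fderiv ℝ (u t) x)) with hZ
  have hTt : 0 < T - t := sub_pos.2 ht.2
  have hcν : 0 < c * ν ^ 3 := mul_pos hc (pow_pos hν 3)
  -- the enstrophy at time `t` is finite
  have hZtop : Z ≠ ⊤ := by
    intro h
    have h' : Z ^ 2 * ENNReal.ofReal (T - t) = ⊤ := by
      rw [h, pow_two, ENNReal.top_mul_top, ENNReal.top_mul (ENNReal.ofReal_pos.2 hTt).ne']
    rw [h'] at hlt
    exact not_top_lt hlt
  set a : ℝ := Z.toReal with ha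
  have ha0 : 0 ≤ a := ENNReal.toReal_nonneg
  have hZa : Z = ENNReal.ofReal a := (ENNReal.ofReal_toReal hZtop).symm
  -- the smallness in real form: `a² (T - t) < c ν³`
  have hsmall : a ^ 2 * (T - t) < c * ν ^ 3 := by
    rw [hZa, ← ENNReal.ofReal_pow ha0, ← ENNReal.ofReal_mul (sq_nonneg a),
      ENNReal.ofReal_lt_ofReal_iff hcν] at hlt
    exact hlt
  -- a lifespan `τ > T - t` with `a² τ ≤ c ν³`
  set τ : ℝ := (c * ν ^ 3 + (T - t)) / (a ^ 2 + 1) with hτ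
  have ha1 : 0 < a ^ 2 + 1 := by positivity
  have hτpos : 0 < τ := div_pos (by linarith) ha1
  have hτc : a ^ 2 * τ ≤ c * ν ^ 3 := by
    rw [hτ, mul_div_assoc', div_le_iff₀ ha1]
    nlinarith [hsmall.le, sq_nonneg a]
  have hτT : T - t < τ := by
    rw [hτ, lt_div_iff₀ ha1]
    nlinarith [hsmall]
  have htτ : T < t + τ := by linarith
  -- the datum `u t ∈ H¹`, divergence free, with `‖∇u(t)‖² ≤ a`
  have hu2 : MemLp (u t) 2 volume := hLH.memLp t ⟨ht.1, ht.2.le⟩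
  have hT₁ : (t + T) / 2 ∈ Ioo t T := ⟨by linarith [ht.2], by linarith [ht.2]⟩
  have hdiv : IsWeaklyDivFree (u t) :=
    (hrestart _ hT₁).isWeaklyDivFree_datum (by linarith [ht.2] : 0 < (t + T) / 2 - t)
  have hgrad : eWeakGradL2Sq (u t) ≤ ENNReal.ofReal a := by
    have hC1 : ContDiff ℝ 1 (u t) := (hcl.contDiff_velocity ht).of_le (by exact_mod_cast le_top)
    exact (eWeakGradL2Sq_le_of_hasWeakGradient (hasWeakGradient_fderiv_of_contDiff hC1)).trans_eq hZa
  -- Leray's local strong solution `v` from `u t` on `[0, τ]` (RRS Thm. 6.15)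
  obtain ⟨v, hv, -, hvreg⟩ := hloc hν hτpos hu2 hdiv ha0 hgrad hτc
  -- its classical representative `(V, P)` on `(0, τ]` (RRS Thm. 8.17, first clause, `L^∞_t L⁶_x`)
  have hvS : MemLqLp ∞ 6 v (Ioo 0 τ) :=
    memLqLp_top_six_of_isH1RegularOn_Icc hvreg fun s hs => hv.memLp s hs
  have hr6 : (3 : ℝ≥0∞) < 6 := by norm_num
  obtain ⟨V, P, hVP, hvV⟩ := hLPS hν hτpos hv hr6 serrin_exponents_top_six hvS
  -- everywhere agreement of the continuous slices on `(t, T)` (weak–strong uniqueness on each `[0, T₂ - t)`)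
  have heq : ∀ t' ∈ Ioo t T, u t' = V (t' + -t) := by
    intro t' ht'
    have hT₂ : (t' + T) / 2 ∈ Ioo t T := ⟨by linarith [ht'.1, ht'.2], by linarith [ht'.2]⟩
    have hT₂t : 0 < (t' + T) / 2 - t := by linarith [hT₂.1]
    have hT₂τ : (t' + T) / 2 - t ≤ τ := by linarith [hT₂.2]
    have hae : ∀ s ∈ Ioc 0 ((t' + T) / 2 - t), (fun s => u (s + t)) s =ᵐ[volume] v s :=
      serrin_weak_strong_uniqueness_holds hν hT₂t (hv.of_le hT₂τ) hu2 (q := ∞) (r := 6) hr6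
        serrin_exponents_top_six (hvS.mono_set (Ioo_subset_Ioo_right hT₂τ)) (hrestart _ hT₂)
    have hts : t' - t ∈ Ioc 0 ((t' + T) / 2 - t) := ⟨sub_pos.2 ht'.1, by linarith [ht'.2]⟩
    have h1 : u t' =ᵐ[volume] v (t' - t) := by
      have h := hae (t' - t) hts
      simpa only [sub_add_cancel] using h
    have h2 : v (t' - t) =ᵐ[volume] V (t' - t) := hvV (t' - t) ⟨hts.1, hts.2.trans hT₂τ⟩
    have hcu : Continuous (u t') := (hcl.contDiff_velocity ⟨ht.1.trans ht'.1.le, ht'.2⟩).continuous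
    have hcV : Continuous (V (t' - t)) := (hVP.contDiff_velocity ⟨hts.1, hts.2.trans hT₂τ⟩).continuous
    rw [← sub_eq_add_neg]
    exact (Continuous.ae_eq_iff_eq volume hcu hcV).1 (h1.trans h2)
  -- the continuation piece `(V, P)(· - t)` on `(t, t + τ)`
  have h₂ : IsClassicalNSSolutionOn (Ioo t (t + τ)) ν 0 (fun s => V (s + -t)) (fun s => P (s + -t)) := by
    have hVP' := hVP.comp_add_right (-t)
    have h0 : (fun s => (0 : ℝ → EuclideanSpace ℝ (Fin 3) → EuclideanSpace ℝ (Fin 3)) (s + -t)) = 0 := rfl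
    rw [h0] at hVP'
    exact hVP'.mono (fun s hs => ⟨by simp only [mem_Ioo] at hs ⊢; linarith [hs.1],
      by simp only [mem_Ioo] at hs ⊢; linarith [hs.2]⟩) isOpen_Ioo.uniqueDiffOn
  -- glue along the overlap `(t, T)`
  exact ⟨t + τ, htτ, _, _, hcl.glue h₂ ht.1 ht.2 htτ.le heq, fun s hs => by simp only [if_pos hs.2]⟩

/-! ## L19: the enstrophy clock -/

/-- **L19 — LERAY'S `H¹` CLOCK (the enstrophy countdown).** There is an absolute constant `c > 0` such that
for every `ν > 0`, `T > 0` and every maximal smooth solution `(u, p)` of the unforced Navier–Stokes system on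
`ℝ³ × [0, T)` which is Leray–Hopf from `u 0`, at EVERY instant `t ∈ [0, T)`:
`c ν³ ≤ (∫|∇u(t)|²)² · (T − t)` (in `ℝ≥0∞`; trivial where the enstrophy is infinite). A flow at enstrophy `Z`
is at least `c ν³/Z²` away from blow-up; the enstrophy diverges at least like `√(c ν³/(T − t))`
(Robinson–Rodrigo–Sadowski 2016, Lemma 6.11; Leray 1934, §20). Proof: otherwise the continuation step
`hasSmoothExtensionPast_of_enstrophy_lt` (fed by the everywhere restart `isLerayHopfOn_translate`, and by the
Leray–Hopf hypothesis itself at `t = 0`) contradicts maximality.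
[cite: RobinsonRodrigoSadowski2016, Lemma 6.11 with Thm. 6.15] [cite: Leray1934, §20] -/
theorem enstrophy_clock :
    ∃ c : ℝ, 0 < c ∧ ∀ (ν T : ℝ), 0 < ν → 0 < T →
      ∀ (u : ℝ → EuclideanSpace ℝ (Fin 3) → EuclideanSpace ℝ (Fin 3)) (p : ℝ → EuclideanSpace ℝ (Fin 3) → ℝ),
      IsMaximalSmoothSolution ν 0 u p T → IsLerayHopfOn T ν 0 (u 0) u →
      ∀ t ∈ Ico 0 T, ENNReal.ofReal (c * ν ^ 3) ≤
        (∫⁻ x, ENNReal.ofReal (frobeniusNormSq (fderiv ℝ (u t) x))) ^ 2 * ENNReal.ofReal (T - t) := by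
  obtain ⟨c, hc, hloc⟩ := leray_local_strong_H1_of_regular leray_local_regular_H1_holds
  refine ⟨c, hc, fun ν T hν hT u p hmax hLH t ht => ?_⟩
  by_contra hlt
  rw [not_le] at hlt
  refine hmax.2 (hasSmoothExtensionPast_of_enstrophy_lt hν hc hloc hmax.1 hLH ht (fun T₂ hT₂ => ?_) hlt)
  rcases ht.1.eq_or_lt with h0 | h0
  · subst h0
    simp only [sub_zero, add_zero]
    exact hLH.of_le hT₂.2.le
  · exact isLerayHopfOn_translate hν hT hmax.1 hLH ⟨h0, ht.2⟩ hT₂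

/-- For `t ∈ (0, T)` the slice `u(t)` is a smooth `L²` field, and its enstrophy is the toolbox gradient energy
`gradSq (u t) = ∑_i ‖∂_i u(t)‖₂²`, which is finite. [folklore] -/
theorem lintegral_frobeniusNormSq_eq_gradSq {ν T : ℝ} (hν : 0 < ν) (hT : 0 < T)
    {u : ℝ → EuclideanSpace ℝ (Fin 3) → EuclideanSpace ℝ (Fin 3)} {p : ℝ → EuclideanSpace ℝ (Fin 3) → ℝ}
    (hmax : IsMaximalSmoothSolution ν 0 u p T) (hLH : IsLerayHopfOn T ν 0 (u 0) u)
    {t : ℝ} (ht : t ∈ Ioo 0 T) :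
    (∫⁻ x, ENNReal.ofReal (frobeniusNormSq (fderiv ℝ (u t) x))) = gradSq (u t) ∧ gradSq (u t) ≠ ⊤ := by
  have hw : IsSmoothL2Field (u t) := isSmoothL2Field_slice_of_maximal hν hT hmax hLH ht
  refine ⟨(sum_eLpNorm_fderiv_sq_eq_lintegral hw).symm, ?_⟩
  unfold gradSq
  exact (ENNReal.sum_lt_top.2 fun i _ =>
    ENNReal.pow_lt_top (hw.memLp_fderiv_apply _).eLpNorm_lt_top).ne

/-- **L19 in real numbers.** With the constant `c` of `enstrophy_clock`: for every `t ∈ (0, T)` the enstrophy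
`Z(t) = (∫|∇u(t)|²)` is finite and `c ν³ ≤ Z(t)² (T − t)`, i.e. `T − t ≥ c ν³ / Z(t)²`.
[cite: RobinsonRodrigoSadowski2016, Lemma 6.11] -/
theorem enstrophy_clock_toReal :
    ∃ c : ℝ, 0 < c ∧ ∀ (ν T : ℝ), 0 < ν → 0 < T →
      ∀ (u : ℝ → EuclideanSpace ℝ (Fin 3) → EuclideanSpace ℝ (Fin 3)) (p : ℝ → EuclideanSpace ℝ (Fin 3) → ℝ),
      IsMaximalSmoothSolution ν 0 u p T → IsLerayHopfOn T ν 0 (u 0) u →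
      ∀ t ∈ Ioo 0 T, c * ν ^ 3 ≤
        (∫⁻ x, ENNReal.ofReal (frobeniusNormSq (fderiv ℝ (u t) x))).toReal ^ 2 * (T - t) := by
  obtain ⟨c, hc, H⟩ := enstrophy_clock
  refine ⟨c, hc, fun ν T hν hT u p hmax hLH t ht => ?_⟩
  have h := H ν T hν hT u p hmax hLH t ⟨ht.1.le, ht.2⟩
  obtain ⟨hZ, hZtop⟩ := lintegral_frobeniusNormSq_eq_gradSq hν hT hmax hLH ht
  rw [hZ] at h ⊢
  have hTt : 0 ≤ T - t := (sub_pos.2 ht.2).le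
  rw [← ENNReal.ofReal_toReal hZtop, ← ENNReal.ofReal_pow ENNReal.toReal_nonneg,
    ← ENNReal.ofReal_mul (sq_nonneg _), ENNReal.ofReal_le_ofReal_iff (by positivity)] at h
  exact h

end Summit.NavierStokesRegularity.FluidComputer.LerayClock

end
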